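import Summits.ResolutionOfSingularities.ResolutionOfSingularities.Theorems.HilbertSamuelEliminationSigmaMaxModificationsCorridor3WLadderSegmentsHEmpBirths
import HarnessLib

/-!
# [OURS · L1 W4.2] (H-emp) WITHIN THE UNIT — STRONG-INDUCTION FORM: the geometric inputs at a birth stage `n + 1` may use EVERYTHING the
# invariant knows at the stages `≤ n` (centres vs. near loci, dichotomy, regularity), so that the near-point geometry of ONE blow-up
# (CJS Lemma 6.33 / Def. 6.34, recognition geometry (R2)–(R4)) can be plugged in stage by stage
# (crux `SigmaMaxModifications` stmt-ResolutionOfSingularities-18506; conjunct `SigmaMaxModificationsCorridor3` stmt-…-19249; line `w_ladder`; RECOGNITION (R5))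

Stub worker res-L1-w42-stub-1 (gen 4). Helper file `--supports stmt-ResolutionOfSingularities-19249 --as helper`; kernel only, FACT-FREE, no new
definition. Strengthening of `…SegmentsHEmpBirths`: there (Dich)/(RegN) at a birth stage `n + 1` (after a genuine step `n`) were plain
hypotheses. The geometric analysis of the near points of the blow-up `X_{b+n+1} → X_{b+n}` over `N_n` needs to know that the centre IS the
near locus near `x_b` (`N_n ⊆ C_{b+n}`, hence `(locTower b).C n = ι_n⁻¹ N_n`, `…CentreNear.locTower_C_eq_preimage_nearLocus`) and the shape of
`N_m`, `m ≤ n` — facts the invariant itself produces. `Seg.invariant_strong` runs the induction with the birth hypothesis in the form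
«given the invariant's data at all stages `m ≤ n`, produce (Dich)/(RegN) at `n + 1`», and delivers at every stage `n < M`: genuine ⇒
`N_n ⊆ C_{b+n}`, waiting ⇒ `C_{b+n} ∩ N_n = ∅`, (Dich_n), (RegN_n), and for `0 < n` one label + replay avoidance. Corollaries:
`Seg.dich_regN_of_birthsStrong` (the inputs of every `M`-hypothesis theorem of `…SegmentsHEmp` / `…ExtractU` / `…CentreNear`) and
`Seg.locTower_C_eq_empty_of_birthsStrong` ((H-emp) within the unit).

OURS bookkeeping; NOT a statement of the manuscript [Hironaka2017] nor of [CossartJannsenSaito2020]. AI-written; AI review is weaker than expert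
review.

References: V. Cossart, U. Jannsen, S. Saito, LNM 2270 (2020), Rem. 6.29 (1), Lemma 6.33, Def. 6.34, Def. 6.38, p. 105 [CossartJannsenSaito2020].
-/

noncomputable section

set_option linter.dupNamespace false -- namespace `…Corridor3.Moving` re-enters `…Corridor3` (module convention of the Moving files)

open CategoryTheory AlgebraicGeometry TopologicalSpace Topology IsLocalRing
open Literature.AlgebraicGeometry.Resolution Literature.RingTheory.HilbertSamuel
open Literature.AlgebraicGeometry.CossartJannsenSaito2020
open Summit.ResolutionOfSingularities.ResolutionOfSingularities.Theorems.CampaignW42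
open Summit.ResolutionOfSingularities.ResolutionOfSingularities.Theorems.SigmaMaxModificationsCorridor3.Helpers

namespace Summit.ResolutionOfSingularities.ResolutionOfSingularities.Theorems.SigmaMaxModificationsCorridor3.Moving.Seg

variable {R : ∀ S : Scheme.{0}, CentreSeq S → Prop} {N : ℕ} {ν : ℕ → ℕ} {k : Type} [Field k]
  {c : ℕ → MarkedStage.{0}} (hc : ∀ n, CanonicalNearStep R N ν (c n) (c (n + 1))) (hRf : OracleFunctional R) (hRa : OracleAdmissible R)
  (hν : ν ≠ iterPSum N Phi) (h0 : Helpers.CycleInv k N ν (c 0))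
  {p : ℕ} {X : Scheme.{0}} [IsLocallyNoetherian X] {x : X} (hX : IsMaximalOrigin p N ν X x)
  (hreach : Reaches R N ν (MarkedStage.init X x) (c 0))

include hRf hX hreach in
/-- **CENTRE VS. NEAR LOCUS FROM THE PER-STAGE INVARIANT**: with one label, replay avoidance, (Dich) and (RegN) at the stage, a genuine step's
centre contains `N_n` and a waiting step's centre misses it. [cite: CossartJannsenSaito2020, Def. 6.38 (iii), Rem. 6.29 (1)] -/
theorem centre_vs_nearLocus_of_stage (b : ℕ)
    (hU : ∃ U : Set (c b).W, IsOpen U ∧ (c b).pt ∈ U ∧ U ∩ Scheme.hsStratum (c b).W N ν ⊆ {(c b).pt}) (n : ℕ)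
    (hone : ∀ Z₁ ∈ componentsIn (Scheme.hsStratum (c (b + n)).W N ν), ∀ Z₂ ∈ componentsIn (Scheme.hsStratum (c (b + n)).W N ν),
      Z₁ ⊆ (upTower hc hRa hν h0 b).nearLocus N (c b).pt n → Z₂ ⊆ (upTower hc hRa hν h0 b).nearLocus N (c b).pt n →
        (c (b + n)).L.label Z₁ = (c (b + n)).L.label Z₂)
    (hRA : ∀ Q, (c (b + n)).P = some Q → Q.rest.CentresOver (Q.hom.base ⁻¹' ((upTower hc hRa hν h0 b).nearLocus N (c b).pt n)ᶜ))
    (hD : (((upTower hc hRa hν h0 b).nearLocus N (c b).pt n).Infinite ∧ IsIrreducible ((upTower hc hRa hν h0 b).nearLocus N (c b).pt n)) ∨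
      (((upTower hc hRa hν h0 b).nearLocus N (c b).pt n).Finite ∧
        ∀ y ∈ (upTower hc hRa hν h0 b).nearLocus N (c b).pt n, IsClosed ({y} : Set (c (b + n)).W)))
    (hR : ((upTower hc hRa hν h0 b).nearLocus N (c b).pt n).Infinite →
      ∀ h : IsClosed ((upTower hc hRa hν h0 b).nearLocus N (c b).pt n),
        Scheme.IsRegular (Scheme.IdealSheafData.vanishingIdeal ⟨(upTower hc hRa hν h0 b).nearLocus N (c b).pt n, h⟩).subscheme) :
    ((c (b + n)).IsBlownUp R N ν → (upTower hc hRa hν h0 b).nearLocus N (c b).pt n ⊆ (upTower hc hRa hν h0 b).C n) ∧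
    (¬ (c (b + n)).IsBlownUp R N ν → (upTower hc hRa hν h0 b).C n ∩ (upTower hc hRa hν h0 b).nearLocus N (c b).pt n = ∅) := by
  obtain ⟨P', hcs⟩ := Helpers.isCanonicalStep_chainCentre (shiftStep hc b) n
  have hregT := fun j h z hz => part_regular_along_nearLocus hc hRa hν h0 hX hreach b hU n hone hD hR j h z hz
  -- a centre meeting `N_n` contains it
  have key : ((upTower hc hRa hν h0 b).C n ∩ (upTower hc hRa hν h0 b).nearLocus N (c b).pt n).Nonempty →
      (upTower hc hRa hν h0 b).nearLocus N (c b).pt n ⊆ (upTower hc hRa hν h0 b).C n := fun hmeet => by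
    obtain ⟨ℓ, hℓ⟩ := exists_part_of_centre_meets hRa hRA (fun _ j h _ z hz => hregT j h z hz) hcs hmeet
    have hmeet' : ((c (b + n)).L.part (Scheme.hsStratum (c (b + n)).W N ν) ℓ ∩ (upTower hc hRa hν h0 b).nearLocus N (c b).pt n).Nonempty := by
      rw [← hℓ]; exact hmeet
    have hsub := nearLocus_subset_part_of_meets hc hRa hν h0 hX hreach b hU n hone hmeet'
    rw [← hℓ] at hsub
    exact hsub
  refine ⟨fun hg => ?_, fun hw => ?_⟩
  · obtain ⟨C₁, P₁, hcs₁, hx₁⟩ := hg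
    obtain rfl : C₁ = Helpers.chainCentre (shiftStep hc b) n := hcs₁.centre_unique hRf hcs
    exact key ⟨_, hx₁, pt_mem_nearLocus hc hRa hν h0 hX hreach b n⟩
  · by_contra hne
    exact hw ⟨_, P', hcs, key (Set.nonempty_iff_ne_empty.mpr hne) (pt_mem_nearLocus hc hRa hν h0 hX hreach b n)⟩

include hRf hX hreach in
/-- **THE INVARIANT OF THE UNIT, STRONG-INDUCTION FORM.** Base `b` blown up at a marked point isolated in the Hilbert–Samuel locus; `M` a bound.
BIRTH HYPOTHESIS: at every genuine step `n` with `n + 1 < M`, GIVEN at all stages `m ≤ n` the data «genuine ⇒ `N_m ⊆ C_{b+m}`», «waiting ⇒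
`C_{b+m} ∩ N_m = ∅`», (Dich_m), (RegN_m), produce (Dich_{n+1}) and (RegN_{n+1}). CONCLUSION: that data at every `n < M`, and one label +
replay avoidance at every `0 < n < M`. [cite: CossartJannsenSaito2020, Rem. 6.29 (1), Lemma 6.33, Def. 6.34, Def. 6.38] -/
theorem invariant_strong (b : ℕ) (hb : (c b).IsBlownUp R N ν) (hiso : Iso N (c b)) (M : ℕ)
    (hBirth : ∀ n, n + 1 < M → (c (b + n)).IsBlownUp R N ν →
      (∀ m, m ≤ n →
        ((c (b + m)).IsBlownUp R N ν → (upTower hc hRa hν h0 b).nearLocus N (c b).pt m ⊆ (upTower hc hRa hν h0 b).C m) ∧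
        (¬ (c (b + m)).IsBlownUp R N ν → (upTower hc hRa hν h0 b).C m ∩ (upTower hc hRa hν h0 b).nearLocus N (c b).pt m = ∅) ∧
        ((((upTower hc hRa hν h0 b).nearLocus N (c b).pt m).Infinite ∧ IsIrreducible ((upTower hc hRa hν h0 b).nearLocus N (c b).pt m)) ∨
          (((upTower hc hRa hν h0 b).nearLocus N (c b).pt m).Finite ∧
            ∀ y ∈ (upTower hc hRa hν h0 b).nearLocus N (c b).pt m, IsClosed ({y} : Set (c (b + m)).W))) ∧
        (((upTower hc hRa hν h0 b).nearLocus N (c b).pt m).Infinite →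
          ∀ h : IsClosed ((upTower hc hRa hν h0 b).nearLocus N (c b).pt m),
            Scheme.IsRegular (Scheme.IdealSheafData.vanishingIdeal ⟨(upTower hc hRa hν h0 b).nearLocus N (c b).pt m, h⟩).subscheme)) →
      ((((upTower hc hRa hν h0 b).nearLocus N (c b).pt (n + 1)).Infinite ∧ IsIrreducible ((upTower hc hRa hν h0 b).nearLocus N (c b).pt (n + 1))) ∨
        (((upTower hc hRa hν h0 b).nearLocus N (c b).pt (n + 1)).Finite ∧
          ∀ y ∈ (upTower hc hRa hν h0 b).nearLocus N (c b).pt (n + 1), IsClosed ({y} : Set (c (b + (n + 1))).W))) ∧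
      (((upTower hc hRa hν h0 b).nearLocus N (c b).pt (n + 1)).Infinite →
        ∀ h : IsClosed ((upTower hc hRa hν h0 b).nearLocus N (c b).pt (n + 1)),
          Scheme.IsRegular (Scheme.IdealSheafData.vanishingIdeal ⟨(upTower hc hRa hν h0 b).nearLocus N (c b).pt (n + 1), h⟩).subscheme)) :
    ∀ n, n < M →
      (((c (b + n)).IsBlownUp R N ν → (upTower hc hRa hν h0 b).nearLocus N (c b).pt n ⊆ (upTower hc hRa hν h0 b).C n) ∧
        (¬ (c (b + n)).IsBlownUp R N ν → (upTower hc hRa hν h0 b).C n ∩ (upTower hc hRa hν h0 b).nearLocus N (c b).pt n = ∅) ∧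
        ((((upTower hc hRa hν h0 b).nearLocus N (c b).pt n).Infinite ∧ IsIrreducible ((upTower hc hRa hν h0 b).nearLocus N (c b).pt n)) ∨
          (((upTower hc hRa hν h0 b).nearLocus N (c b).pt n).Finite ∧
            ∀ y ∈ (upTower hc hRa hν h0 b).nearLocus N (c b).pt n, IsClosed ({y} : Set (c (b + n)).W))) ∧
        (((upTower hc hRa hν h0 b).nearLocus N (c b).pt n).Infinite →
          ∀ h : IsClosed ((upTower hc hRa hν h0 b).nearLocus N (c b).pt n),
            Scheme.IsRegular (Scheme.IdealSheafData.vanishingIdeal ⟨(upTower hc hRa hν h0 b).nearLocus N (c b).pt n, h⟩).subscheme)) ∧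
      (0 < n →
        (∀ Z₁ ∈ componentsIn (Scheme.hsStratum (c (b + n)).W N ν), ∀ Z₂ ∈ componentsIn (Scheme.hsStratum (c (b + n)).W N ν),
          Z₁ ⊆ (upTower hc hRa hν h0 b).nearLocus N (c b).pt n → Z₂ ⊆ (upTower hc hRa hν h0 b).nearLocus N (c b).pt n →
            (c (b + n)).L.label Z₁ = (c (b + n)).L.label Z₂) ∧
        ∀ Q, (c (b + n)).P = some Q → Q.rest.CentresOver (Q.hom.base ⁻¹' ((upTower hc hRa hν h0 b).nearLocus N (c b).pt n)ᶜ)) := by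
  obtain ⟨k', _, _, hg⟩ := hX.exists_stateGood_of_reaches hRa hν (reaches_chain hreach hc b)
  have hU := stratumIsolated_of_iso hg hiso
  obtain ⟨hN0, hD0, hone0⟩ := nearLocus_base hc hRa hν h0 hX hreach b
  -- stage 0 data
  have hR0 : ((upTower hc hRa hν h0 b).nearLocus N (c b).pt 0).Infinite →
      ∀ h : IsClosed ((upTower hc hRa hν h0 b).nearLocus N (c b).pt 0),
        Scheme.IsRegular (Scheme.IdealSheafData.vanishingIdeal ⟨(upTower hc hRa hν h0 b).nearLocus N (c b).pt 0, h⟩).subscheme := by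
    intro hinf; exfalso; apply hinf; rw [hN0]; exact Set.finite_singleton _
  have hCN0 : ((c (b + 0)).IsBlownUp R N ν → (upTower hc hRa hν h0 b).nearLocus N (c b).pt 0 ⊆ (upTower hc hRa hν h0 b).C 0) ∧
      (¬ (c (b + 0)).IsBlownUp R N ν → (upTower hc hRa hν h0 b).C 0 ∩ (upTower hc hRa hν h0 b).nearLocus N (c b).pt 0 = ∅) := by
    refine ⟨fun hg => ?_, fun hw => absurd hb hw⟩
    obtain ⟨P', hcs⟩ := Helpers.isCanonicalStep_chainCentre (shiftStep hc b) 0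
    obtain ⟨C₁, P₁, hcs₁, hx₁⟩ := hg
    obtain rfl : C₁ = Helpers.chainCentre (shiftStep hc b) 0 := hcs₁.centre_unique hRf hcs
    rw [hN0]; exact Set.singleton_subset_iff.mpr hx₁
  -- strong induction: all stages `m ≤ n` at once
  suffices H : ∀ n, ∀ m, m ≤ n → m < M →
      (((c (b + m)).IsBlownUp R N ν → (upTower hc hRa hν h0 b).nearLocus N (c b).pt m ⊆ (upTower hc hRa hν h0 b).C m) ∧
        (¬ (c (b + m)).IsBlownUp R N ν → (upTower hc hRa hν h0 b).C m ∩ (upTower hc hRa hν h0 b).nearLocus N (c b).pt m = ∅) ∧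
        ((((upTower hc hRa hν h0 b).nearLocus N (c b).pt m).Infinite ∧ IsIrreducible ((upTower hc hRa hν h0 b).nearLocus N (c b).pt m)) ∨
          (((upTower hc hRa hν h0 b).nearLocus N (c b).pt m).Finite ∧
            ∀ y ∈ (upTower hc hRa hν h0 b).nearLocus N (c b).pt m, IsClosed ({y} : Set (c (b + m)).W))) ∧
        (((upTower hc hRa hν h0 b).nearLocus N (c b).pt m).Infinite →
          ∀ h : IsClosed ((upTower hc hRa hν h0 b).nearLocus N (c b).pt m),
            Scheme.IsRegular (Scheme.IdealSheafData.vanishingIdeal ⟨(upTower hc hRa hν h0 b).nearLocus N (c b).pt m, h⟩).subscheme)) ∧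
      (0 < m →
        (∀ Z₁ ∈ componentsIn (Scheme.hsStratum (c (b + m)).W N ν), ∀ Z₂ ∈ componentsIn (Scheme.hsStratum (c (b + m)).W N ν),
          Z₁ ⊆ (upTower hc hRa hν h0 b).nearLocus N (c b).pt m → Z₂ ⊆ (upTower hc hRa hν h0 b).nearLocus N (c b).pt m →
            (c (b + m)).L.label Z₁ = (c (b + m)).L.label Z₂) ∧
        ∀ Q, (c (b + m)).P = some Q → Q.rest.CentresOver (Q.hom.base ⁻¹' ((upTower hc hRa hν h0 b).nearLocus N (c b).pt m)ᶜ)) from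
    fun n hn => H n n le_rfl hn
  intro n
  induction n with
  | zero =>
    intro m hm _
    obtain rfl : m = 0 := Nat.le_zero.mp hm
    exact ⟨⟨hCN0.1, hCN0.2, hD0, hR0⟩, fun h => absurd h (lt_irrefl 0)⟩
  | succ n ih =>
    intro m hm hmM
    rcases Nat.lt_or_ge m (n + 1) with hlt | hge
    · exact ih m (Nat.lt_succ_iff.mp hlt) hmM
    obtain rfl : m = n + 1 := le_antisymm hm hge
    have hnM : n < M := Nat.lt_of_succ_lt hmM
    have ihn := ih n le_rfl hnM
    obtain ⟨⟨hCNn, hCNn', hDn, hRn⟩, hposn⟩ := ihn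
    -- (Dich)/(RegN) at `n + 1`
    have hnext : ((((upTower hc hRa hν h0 b).nearLocus N (c b).pt (n + 1)).Infinite ∧
          IsIrreducible ((upTower hc hRa hν h0 b).nearLocus N (c b).pt (n + 1))) ∨
        (((upTower hc hRa hν h0 b).nearLocus N (c b).pt (n + 1)).Finite ∧
          ∀ y ∈ (upTower hc hRa hν h0 b).nearLocus N (c b).pt (n + 1), IsClosed ({y} : Set (c (b + (n + 1))).W))) ∧
        (((upTower hc hRa hν h0 b).nearLocus N (c b).pt (n + 1)).Infinite →
          ∀ h : IsClosed ((upTower hc hRa hν h0 b).nearLocus N (c b).pt (n + 1)),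
            Scheme.IsRegular (Scheme.IdealSheafData.vanishingIdeal ⟨(upTower hc hRa hν h0 b).nearLocus N (c b).pt (n + 1), h⟩).subscheme) := by
      by_cases hBn : (c (b + n)).IsBlownUp R N ν
      · exact hBirth n hmM hBn fun m hm => (ih m hm (lt_of_le_of_lt hm hnM)).1
      · have hdisj := hCNn' hBn
        refine ⟨dich_succ_of_disjoint hc hRa hν h0 hX hreach b n hdisj hDn, fun hinf h' => ?_⟩
        have hinfn : ((upTower hc hRa hν h0 b).nearLocus N (c b).pt n).Infinite := by
          intro hfin
          rw [nearLocus_succ_eq_preimage hc hRa hν h0 b n hdisj] at hinf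
          refine hinf (hfin.preimage fun z₁ _ z₂ hz₂ h => ?_)
          have hout : ((upTower hc hRa hν h0 b).π n).base z₂ ∉ (upTower hc hRa hν h0 b).C n := fun hC => by
            have : _ ∈ (upTower hc hRa hν h0 b).C n ∩ (upTower hc hRa hν h0 b).nearLocus N (c b).pt n := ⟨hC, hz₂⟩
            rw [hdisj] at this; exact this
          obtain ⟨z, -, huniq⟩ := exists_unique_preimage_of_not_mem_C (upTower hc hRa hν h0 b) n hout
          exact (huniq z₁ h).trans (huniq z₂ rfl).symm
        exact regN_succ_of_disjoint hc hRa hν h0 hX hreach b n hdisj (hRn hinfn) h'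
    -- one label and replay avoidance at `n + 1`
    have hlab : (∀ Z₁ ∈ componentsIn (Scheme.hsStratum (c (b + (n + 1))).W N ν), ∀ Z₂ ∈ componentsIn (Scheme.hsStratum (c (b + (n + 1))).W N ν),
          Z₁ ⊆ (upTower hc hRa hν h0 b).nearLocus N (c b).pt (n + 1) → Z₂ ⊆ (upTower hc hRa hν h0 b).nearLocus N (c b).pt (n + 1) →
            (c (b + (n + 1))).L.label Z₁ = (c (b + (n + 1))).L.label Z₂) ∧
        ∀ Q, (c (b + (n + 1))).P = some Q → Q.rest.CentresOver (Q.hom.base ⁻¹' ((upTower hc hRa hν h0 b).nearLocus N (c b).pt (n + 1))ᶜ) := by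
      rcases Nat.eq_zero_or_pos n with rfl | hpos
      · refine ⟨oneLabel_succ hc hRa hν h0 hX hreach b hU 0 hD0 hnext.1 hone0, fun Q hQ => ?_⟩
        have hnone : (c (b + 1)).P = none := P_succ_eq_none_of_isBlownUp_of_iso hc hRf hRa hν hX hreach b hb hiso
        exact absurd (hnone.symm.trans hQ) (by simp)
      · obtain ⟨hone, hRA⟩ := hposn hpos
        refine ⟨oneLabel_succ hc hRa hν h0 hX hreach b hU n hDn hnext.1 hone, ?_⟩
        have hf : StepProjection R N ν (c (b + n)) (c (b + (n + 1))) ((upTower hc hRa hν h0 b).π n) :=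
          Helpers.stepProjection_chainProj (shiftStep hc b) n
        exact replayAvoid_step hRa hf (image_nearLocus_succ_subset hc hRa hν h0 b n) hRA
          fun _ j h _ z hz => part_regular_along_nearLocus hc hRa hν h0 hX hreach b hU n hone hDn hRn j h z hz
    have hCN := centre_vs_nearLocus_of_stage hc hRf hRa hν h0 hX hreach b hU (n + 1) hlab.1 hlab.2 hnext.1 hnext.2
    exact ⟨⟨hCN.1, hCN.2, hnext.1, hnext.2⟩, fun _ => hlab⟩

include hRf hX hreach in
/-- **(Dich)/(RegN) at all stages `0 < n < M` from the strong birth hypothesis** — feeds `Seg.locTower_C_eq_empty_of_lt`, `Seg.hEmpU_of_nearLocus_geometry`,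
`Seg.unitTowerU_C_eq_nearLocus`, `Seg.unitCentreDiscipline_of_geometry`. [cite: CossartJannsenSaito2020, Lemma 6.33, Def. 6.34] -/
theorem dich_regN_of_birthsStrong (b : ℕ) (hb : (c b).IsBlownUp R N ν) (hiso : Iso N (c b)) (M : ℕ)
    (hBirth : ∀ n, n + 1 < M → (c (b + n)).IsBlownUp R N ν →
      (∀ m, m ≤ n →
        ((c (b + m)).IsBlownUp R N ν → (upTower hc hRa hν h0 b).nearLocus N (c b).pt m ⊆ (upTower hc hRa hν h0 b).C m) ∧
        (¬ (c (b + m)).IsBlownUp R N ν → (upTower hc hRa hν h0 b).C m ∩ (upTower hc hRa hν h0 b).nearLocus N (c b).pt m = ∅) ∧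
        ((((upTower hc hRa hν h0 b).nearLocus N (c b).pt m).Infinite ∧ IsIrreducible ((upTower hc hRa hν h0 b).nearLocus N (c b).pt m)) ∨
          (((upTower hc hRa hν h0 b).nearLocus N (c b).pt m).Finite ∧
            ∀ y ∈ (upTower hc hRa hν h0 b).nearLocus N (c b).pt m, IsClosed ({y} : Set (c (b + m)).W))) ∧
        (((upTower hc hRa hν h0 b).nearLocus N (c b).pt m).Infinite →
          ∀ h : IsClosed ((upTower hc hRa hν h0 b).nearLocus N (c b).pt m),
            Scheme.IsRegular (Scheme.IdealSheafData.vanishingIdeal ⟨(upTower hc hRa hν h0 b).nearLocus N (c b).pt m, h⟩).subscheme)) →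
      ((((upTower hc hRa hν h0 b).nearLocus N (c b).pt (n + 1)).Infinite ∧ IsIrreducible ((upTower hc hRa hν h0 b).nearLocus N (c b).pt (n + 1))) ∨
        (((upTower hc hRa hν h0 b).nearLocus N (c b).pt (n + 1)).Finite ∧
          ∀ y ∈ (upTower hc hRa hν h0 b).nearLocus N (c b).pt (n + 1), IsClosed ({y} : Set (c (b + (n + 1))).W))) ∧
      (((upTower hc hRa hν h0 b).nearLocus N (c b).pt (n + 1)).Infinite →
        ∀ h : IsClosed ((upTower hc hRa hν h0 b).nearLocus N (c b).pt (n + 1)),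
          Scheme.IsRegular (Scheme.IdealSheafData.vanishingIdeal ⟨(upTower hc hRa hν h0 b).nearLocus N (c b).pt (n + 1), h⟩).subscheme)) :
    (∀ n, 0 < n → n < M →
      (((upTower hc hRa hν h0 b).nearLocus N (c b).pt n).Infinite ∧ IsIrreducible ((upTower hc hRa hν h0 b).nearLocus N (c b).pt n)) ∨
      (((upTower hc hRa hν h0 b).nearLocus N (c b).pt n).Finite ∧
        ∀ y ∈ (upTower hc hRa hν h0 b).nearLocus N (c b).pt n, IsClosed ({y} : Set (c (b + n)).W))) ∧
    (∀ n, 0 < n → n < M → ((upTower hc hRa hν h0 b).nearLocus N (c b).pt n).Infinite →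
      ∀ h : IsClosed ((upTower hc hRa hν h0 b).nearLocus N (c b).pt n),
        Scheme.IsRegular (Scheme.IdealSheafData.vanishingIdeal ⟨(upTower hc hRa hν h0 b).nearLocus N (c b).pt n, h⟩).subscheme) :=
  ⟨fun n _ hM => (invariant_strong hc hRf hRa hν h0 hX hreach b hb hiso M hBirth n hM).1.2.2.1,
    fun n _ hM => (invariant_strong hc hRf hRa hν h0 hX hreach b hb hiso M hBirth n hM).1.2.2.2⟩

include hRf hX hreach in
/-- **(H-emp) WITHIN THE UNIT FROM THE STRONG BIRTH HYPOTHESIS.** [cite: CossartJannsenSaito2020, Def. 6.38 (iii), Rem. 6.29 (1)] -/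
theorem locTower_C_eq_empty_of_birthsStrong (b : ℕ) (hb : (c b).IsBlownUp R N ν) (hiso : Iso N (c b)) (M : ℕ)
    (hBirth : ∀ n, n + 1 < M → (c (b + n)).IsBlownUp R N ν →
      (∀ m, m ≤ n →
        ((c (b + m)).IsBlownUp R N ν → (upTower hc hRa hν h0 b).nearLocus N (c b).pt m ⊆ (upTower hc hRa hν h0 b).C m) ∧
        (¬ (c (b + m)).IsBlownUp R N ν → (upTower hc hRa hν h0 b).C m ∩ (upTower hc hRa hν h0 b).nearLocus N (c b).pt m = ∅) ∧
        ((((upTower hc hRa hν h0 b).nearLocus N (c b).pt m).Infinite ∧ IsIrreducible ((upTower hc hRa hν h0 b).nearLocus N (c b).pt m)) ∨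
          (((upTower hc hRa hν h0 b).nearLocus N (c b).pt m).Finite ∧
            ∀ y ∈ (upTower hc hRa hν h0 b).nearLocus N (c b).pt m, IsClosed ({y} : Set (c (b + m)).W))) ∧
        (((upTower hc hRa hν h0 b).nearLocus N (c b).pt m).Infinite →
          ∀ h : IsClosed ((upTower hc hRa hν h0 b).nearLocus N (c b).pt m),
            Scheme.IsRegular (Scheme.IdealSheafData.vanishingIdeal ⟨(upTower hc hRa hν h0 b).nearLocus N (c b).pt m, h⟩).subscheme)) →
      ((((upTower hc hRa hν h0 b).nearLocus N (c b).pt (n + 1)).Infinite ∧ IsIrreducible ((upTower hc hRa hν h0 b).nearLocus N (c b).pt (n + 1))) ∨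
        (((upTower hc hRa hν h0 b).nearLocus N (c b).pt (n + 1)).Finite ∧
          ∀ y ∈ (upTower hc hRa hν h0 b).nearLocus N (c b).pt (n + 1), IsClosed ({y} : Set (c (b + (n + 1))).W))) ∧
      (((upTower hc hRa hν h0 b).nearLocus N (c b).pt (n + 1)).Infinite →
        ∀ h : IsClosed ((upTower hc hRa hν h0 b).nearLocus N (c b).pt (n + 1)),
          Scheme.IsRegular (Scheme.IdealSheafData.vanishingIdeal ⟨(upTower hc hRa hν h0 b).nearLocus N (c b).pt (n + 1), h⟩).subscheme))
    (n : ℕ) (hn : n < M) (hw : ¬ (c (b + n)).IsBlownUp R N ν) : (locTower hc hRa hν h0 b).C n = ∅ := by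
  obtain ⟨k', _, _, hg⟩ := hX.exists_stateGood_of_reaches hRa hν (reaches_chain hreach hc b)
  have hU := stratumIsolated_of_iso hg hiso
  exact (locTower_C_eq_empty_iff hc hRa hν h0 hX hreach b hU n).mpr
    ((invariant_strong hc hRf hRa hν h0 hX hreach b hb hiso M hBirth n hn).1.2.1 hw)

end Summit.ResolutionOfSingularities.ResolutionOfSingularities.Theorems.SigmaMaxModificationsCorridor3.Moving.Seg

end
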